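import Summits.QuantumFields.YangMills.Theorems.ColdStartUniversalityLindebergSwapSmallFieldContinuity
import Literature.MathematicalPhysics.QuantumFieldTheory.Balaban1983to89.BlockAveragingHaarAC
import HarnessLib

/-!
# Crux `ColdStartContinuumCauchy` (stmt-QuantumFields-24810, route `ColdStartUniversality`), LINE 3 «lindeberg_swap»:
# CONTINUITY OF BAŁABAN'S GUARDED AVERAGING OFF THE GUARD LEVEL SETS

Helper file (seat `ym-line-csu-p1`, g9; `--supports stmt-QuantumFields-24810`).  Brick (a4) of the proof plan for the registered rung
`stub_shortWindowSwap` (memo v3 on the crux), generalising `…LindebergSwapSmallFieldContinuity` (p685042) from the cold configuration to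
every REGULAR configuration.  The averaging of record (0.4) on `SU(2)` is `Ū(c) = corr(U,c)·(axial average)` with the guard
`corr = ℰ.avg(loop variables)` if `Small` (all loop variables `‖· − 1‖_op < δ_SU`) and `corr = 1` otherwise; BOTH branches are continuous on
OPEN sets (`Small` is a finite conjunction of strict inequalities; its failure by a STRICT excess `> δ_SU` is open too).  Hence:

* `continuousAt_avgFun_apply` / `continuousAt_avgFun` — `U ↦ Ū(c)` (resp. `U ↦ Ū`) is continuous at every `U` none of whose loop variables
  at `c` (resp. anywhere) lies EXACTLY on the guard sphere `‖· − 1‖_op = δ_SU`;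
* `continuousAt_iter_blockAvg_of_regular` — the `k`-fold averaging of record is continuous at every `U` whose GUARDED iterates
  `Ū^i = Averaging.iter blockAvg i U` (`i < k`) have no loop variable on the guard sphere (induction; composition of `ContinuousAt`);
* `continuousAt_avgField_of_regular`, `continuousAt_stepDown_of_regular` — the skeleton's maps at regular configurations.

So the discontinuity set of every map entering `wdisc_K ∘ stepDown` is contained in the finite union of GUARD LEVEL SETS
`{U | ‖loopHol(Ū^i) c x − 1‖_op = δ_SU}`; bricks (a1)–(a3),(a5) of the plan show these are Haar-null.  THEOREMS ONLY, no sorry.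
HONEST FRAMING: plumbing; LINE 3's XL stubs untouched; no crux, rung or summit is proved; the Yang–Mills mass gap is NOT proved.
-/

set_option autoImplicit false

noncomputable section

namespace Summit.QuantumFields.YangMills.Cruxes.ColdStartContinuumCauchy.LindebergSwap

open scoped BigOperators Topology NNReal
open Filter Set Function
open Literature.MathematicalPhysics.QuantumFieldTheory
open Literature.MathematicalPhysics.QuantumFieldTheory.Balaban1983to89
open Literature.MathematicalPhysics.QuantumLattice
open Literature.MathematicalPhysics.QuantumFieldTheory.Balaban1983to89.BlockAveraging (blockAvg blockAvg_avg avgFun loopHol Idx)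
open Literature.MathematicalPhysics.QuantumFieldTheory.Balaban1983to89.AveragingRT (axialAvg)
open Summit.QuantumFields.BalabanUV.T4Continuum.SubstrateBlockAvgContinuity
  (rawAvg avg_eq_rawAvg_of_small continuousOn_rawAvg_eval continuous_loopHol continuous_axialAvg continuous_dist1_SU
    smallContinuous_expMeanLogSU)

/-! ## §1 One guarded step -/

/-- The small-field condition at a bond is OPEN (finitely many strict inequalities of continuous loop variables). [folklore] -/
theorem isOpen_setOf_small (P : Params) {j : ℕ} (c : PBond P (j + 1)) :
    IsOpen {V : GaugeField P j G2 | BlockAveraging.Small avSU V c} := by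
  have h : {V : GaugeField P j G2 | BlockAveraging.Small avSU V c} = ⋂ x : Idx P, {V | dist1 (loopHol V c x) < (avSU).δ} := by
    ext V
    simp only [Set.mem_setOf_eq, Set.mem_iInter]
    exact Iff.rfl
  rw [h]
  exact isOpen_iInter_of_finite fun x => isOpen_lt (continuous_dist1_SU.comp (continuous_loopHol c x)) continuous_const

/-- **One guarded averaging step is continuous, bondwise, at every field none of whose loop variables at that bond lies exactly on
the guard sphere.** [cite: Balaban1987RG1, (0.4) p.253] -/
theorem continuousAt_avgFun_apply (P : Params) {j : ℕ} (c : PBond P (j + 1)) {V₀ : GaugeField P j G2}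
    (hreg : ∀ x : Idx P, dist1 (loopHol V₀ c x) ≠ (avSU).δ) :
    ContinuousAt (fun V : GaugeField P j G2 => avgFun avSU V c) V₀ := by
  by_cases hS : BlockAveraging.Small avSU V₀ c
  · -- on the open small set the step is the unguarded (continuous) one
    have hev : ∀ᶠ V in 𝓝 V₀, BlockAveraging.Small avSU V c := (isOpen_setOf_small P c).mem_nhds hS
    have hraw : ContinuousAt (fun V : GaugeField P j G2 => rawAvg avSU V c) V₀ :=
      (continuousOn_rawAvg_eval avSU smallContinuous_expMeanLogSU c).continuousAt ((isOpen_setOf_small P c).mem_nhds hS)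
    refine hraw.congr (hev.mono fun V hV => ?_)
    rw [← blockAvg_avg]
    exact (avg_eq_rawAvg_of_small avSU hV).symm
  · -- some loop variable exceeds the guard STRICTLY; that persists nearby, where the step is the axial (continuous) one
    obtain ⟨x, hx⟩ : ∃ x : Idx P, ¬ dist1 (loopHol V₀ c x) < (avSU).δ := not_forall.mp hS
    have hgt : (avSU).δ < dist1 (loopHol V₀ c x) := lt_of_le_of_ne (not_lt.mp hx) (hreg x).symm
    have hev : ∀ᶠ V in 𝓝 V₀, ¬ BlockAveraging.Small avSU V c := by
      have ho : IsOpen {V : GaugeField P j G2 | (avSU).δ < dist1 (loopHol V c x)} :=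
        isOpen_lt continuous_const (continuous_dist1_SU.comp (continuous_loopHol c x))
      filter_upwards [ho.mem_nhds hgt] with V hV hsm
      exact absurd (hsm x) (not_lt.mpr (le_of_lt hV))
    have hax : ContinuousAt (fun V : GaugeField P j G2 => axialAvg V c) V₀ :=
      ((continuous_apply c).comp continuous_axialAvg).continuousAt
    refine hax.congr (hev.mono fun V hV => ?_)
    exact (BlockAveragingHaarAC.avgFun_of_not_small avSU V c hV).symm

/-- **One guarded averaging step is continuous at every field with no loop variable on the guard sphere.** [cite: Balaban1987RG1, (0.4) p.253] -/
theorem continuousAt_avgFun (P : Params) {j : ℕ} {V₀ : GaugeField P j G2}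
    (hreg : ∀ (c : PBond P (j + 1)) (x : Idx P), dist1 (loopHol V₀ c x) ≠ (avSU).δ) :
    ContinuousAt (avgFun avSU : GaugeField P j G2 → GaugeField P (j + 1) G2) V₀ :=
  continuousAt_pi.2 fun c => continuousAt_avgFun_apply P c (hreg c)

/-! ## §2 The iterated averaging at regular configurations -/

/-- **The `k`-fold averaging of record is continuous at every configuration whose guarded iterates of depth `< k` have no loop
variable on the guard sphere.** [cite: Balaban1987RG1, (0.4) p.253] -/
theorem continuousAt_iter_blockAvg_of_regular (P : Params) :
    ∀ (k : ℕ) {U₀ : GaugeField P 0 G2},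
      (∀ i, i < k → ∀ (c : PBond P (i + 1)) (x : Idx P),
        dist1 (loopHol (Averaging.iter (fun j => (blockAvg (P := P) (j := j) avSU : Averaging P j G2)) i U₀) c x) ≠ (avSU).δ) →
      ContinuousAt (Averaging.iter (fun j => (blockAvg (P := P) (j := j) avSU : Averaging P j G2)) k) U₀
  | 0, _, _ => continuousAt_id
  | k + 1, U₀, hreg => by
    have ih := continuousAt_iter_blockAvg_of_regular P k (fun i hi => hreg i (Nat.lt_succ_of_lt hi))
    have hstep : ContinuousAt (avgFun avSU : GaugeField P k G2 → GaugeField P (k + 1) G2)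
        (Averaging.iter (fun j => (blockAvg (P := P) (j := j) avSU : Averaging P j G2)) k U₀) :=
      continuousAt_avgFun P (hreg k (Nat.lt_succ_self k))
    show ContinuousAt ((blockAvg avSU).avg ∘ Averaging.iter (fun j => (blockAvg (P := P) (j := j) avSU : Averaging P j G2)) k) U₀
    rw [blockAvg_avg]
    exact hstep.comp ih

variable (F : T3ContinuumYM3Torus.T3Family)

/-- **`avgField K j` is continuous at every configuration whose guarded iterates of depth `< j` are off the guard spheres.**
[cite: Balaban1987RG1, (0.4) p.253] -/
theorem continuousAt_avgField_of_regular (K j : ℕ) {u₀ : GaugeConfig 3 ((F.P K).sitesPerDir 0) G2}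
    (hreg : ∀ i, i < j → ∀ (c : PBond (F.P K) (i + 1)) (x : Idx (F.P K)),
      dist1 (loopHol (Averaging.iter (fun j => (blockAvg (P := F.P K) (j := j) avSU : Averaging (F.P K) j G2)) i
        (toField F K u₀)) c x) ≠ (avSU).δ) :
    ContinuousAt (avgField F K j) u₀ := by
  unfold avgField
  exact (continuousAt_iter_blockAvg_of_regular (F.P K) j hreg).comp (continuous_toField F K).continuousAt

/-- **`stepDown K` is continuous at every fine configuration with no level-0 loop variable on the guard sphere.**
[cite: Balaban1987RG1, (0.4) p.253] -/
theorem continuousAt_stepDown_of_regular (K : ℕ) {u₀ : GaugeConfig 3 ((F.P (K + 1)).sitesPerDir 0) G2}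
    (hreg : ∀ (c : PBond (F.P (K + 1)) 1) (x : Idx (F.P (K + 1))), dist1 (loopHol (toField F (K + 1) u₀) c x) ≠ (avSU).δ) :
    ContinuousAt (stepDown F K) u₀ := by
  have hrel : Continuous fun (V : GaugeField (F.P (K + 1)) 1 G2) (e : Edge 3 ((F.P K).sitesPerDir 0)) =>
      V ⟨siteDown F K e.1, e.2⟩ := continuous_pi fun _ => continuous_apply _
  have hstep : ContinuousAt (avgFun avSU : GaugeField (F.P (K + 1)) 0 G2 → GaugeField (F.P (K + 1)) 1 G2)
      (toField F (K + 1) u₀) := continuousAt_avgFun (F.P (K + 1)) hreg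
  have hcomp := hstep.comp (continuous_toField F (K + 1)).continuousAt
  have h := hrel.continuousAt.comp hcomp
  -- `stepDown = relabel ∘ (blockAvg avSU).avg ∘ toField`
  have heq : stepDown F K = (fun (V : GaugeField (F.P (K + 1)) 1 G2) (e : Edge 3 ((F.P K).sitesPerDir 0)) =>
      V ⟨siteDown F K e.1, e.2⟩) ∘ (avgFun avSU ∘ toField F (K + 1)) := by
    funext c e
    simp only [Function.comp_apply, stepDown, blockAvg_avg]
  rw [heq]
  exact h

/-! ## §3 The discrepancy to a regular configuration -/

/-- **`wdisc_K(u, u₀) → 0` as `u → u₀` at every configuration `u₀` regular to depth `K`** (all guarded iterates of depth `≤ K − 1`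
off the guard spheres): the identity gauge transformation in the infimum and continuity of the `avgField K j` at `u₀`. [folklore] -/
theorem tendsto_wdisc_of_regular (K : ℕ) {u₀ : GaugeConfig 3 ((F.P K).sitesPerDir 0) G2}
    (hreg : ∀ i, i < K → ∀ (c : PBond (F.P K) (i + 1)) (x : Idx (F.P K)),
      dist1 (loopHol (Averaging.iter (fun j => (blockAvg (P := F.P K) (j := j) avSU : Averaging (F.P K) j G2)) i
        (toField F K u₀)) c x) ≠ (avSU).δ) :
    Tendsto (fun u => wdisc F K u u₀) (𝓝 u₀) (𝓝 0) := by
  -- majorant: `Σ_j w_j fieldDistAt_j(Ū_j, Ū₀_j)`, continuous at `u₀` with value `0`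
  have hmaj : ∀ u, wdisc F K u u₀ ≤ ∑ j ∈ Finset.range (K + 1), ((F.L : ℝ)⁻¹) ^ (K - j) *
      fieldDistAt F K j (avgField F K j u) (avgField F K j u₀) := by
    intro u
    unfold wdisc
    exact Finset.sum_le_sum fun j _ => mul_le_mul_of_nonneg_left (discG_le_fieldDistAt F K j u u₀)
      (pow_nonneg (inv_nonneg.mpr (Nat.cast_nonneg _)) _)
  have hterm : ∀ j ∈ Finset.range (K + 1), Tendsto (fun u =>
      fieldDistAt F K j (avgField F K j u) (avgField F K j u₀)) (𝓝 u₀) (𝓝 0) := by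
    intro j hj
    have hjK : j < K + 1 := Finset.mem_range.mp hj
    have hA : ContinuousAt (avgField F K j) u₀ :=
      continuousAt_avgField_of_regular F K j fun i hi => hreg i (lt_of_lt_of_le hi (Nat.lt_succ_iff.mp hjK))
    have hpair : Tendsto (fun u => (avgField F K j u, avgField F K j u₀)) (𝓝 u₀)
        (𝓝 (avgField F K j u₀, avgField F K j u₀)) := hA.tendsto.prodMk_nhds tendsto_const_nhds
    have hfd : Continuous fun q : GaugeField (F.P K) j G2 × GaugeField (F.P K) j G2 => fieldDistAt F K j q.1 q.2 :=
      Summit.QuantumFields.YangMills.Cruxes.WeightedAlmostInvariance.SynchronousShadow.continuous_fieldDistAt F K j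
    have h := (hfd.tendsto _).comp hpair
    rw [fieldDistAt_self] at h
    exact h
  have hsum := tendsto_finsetSum (Finset.range (K + 1)) fun j hj => (hterm j hj).const_mul (((F.L : ℝ)⁻¹) ^ (K - j))
  simp only [mul_zero, Finset.sum_const_zero] at hsum
  have h0 : ∀ u, 0 ≤ wdisc F K u u₀ := fun u => (wdisc_nonneg_le_four F K u u₀).1
  exact tendsto_of_tendsto_of_tendsto_of_le_of_le tendsto_const_nhds hsum h0 hmaj

end Summit.QuantumFields.YangMills.Cruxes.ColdStartContinuumCauchy.LindebergSwap

end
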